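import Mathlib
import Summits.KontsevichZagierPeriods.Zeta5Search.CasoratianClassBoundProof
import HarnessLib

/-!
# ζ(5) search — THEOREM C for the ζ(5)-coefficient (`WrappedDivisibilityU`) is a THEOREM

Cell `pub-zeta5` (HONEST FRAMING: systematic search; no irrationality claim unless certified), typer seat
generation 8.  Discharges BY NAME gen-2 g6's THEOREM C for `U` (`ClusterValuation.WrappedDivisibilityU`, REPORT-gen2-g6 §3):
in the window `p² > b₀ + 2`, `p ≥ 5`, under `H(5)` (every class with at least two poles has `5 + E_x ≥ 1`), the
ζ(5)-coefficient `U(b) = Σ_q c_{4,q}` is `p`-integral, and `p ∣ U(b)` as soon as `4p ≤ 2d(b) + 3`.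

PROOF.  The residue split for `U` (new here, parallel to gen-2 g8's `W = Ω_p − 𝒦_p`): with the Taylor coefficients
`g⁽⁴⁾_o(k) = [(t+k)^o](t^p − t)^4` (`taylorT4`), `U = Ω⁽⁴⁾_p − 𝒦⁽⁴⁾_p` where `Ω⁽⁴⁾_p = μ_{4p+1} − 4μ_{3p+2} + 6μ_{2p+3} − 4μ_{p+4} + μ_5`
(moments of `R_b`; zero for `4p+1 ≤ 2d+4` by `MomentVanishing`, `p`-integral by `MomentIntegral`) and
`𝒦⁽⁴⁾_p = Σ_{o,q} c_{o,q}(g⁽⁴⁾_o(q+1) − [o=4])`.  The weights satisfy `‖g⁽⁴⁾_o(k) − [o=4]‖_p ≤ p^{−max(4−o,1)}`: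
for `o ≤ 2` because `(t^p−t)^4 = F(s)^4` with `F(s) = (s−k)^p − (s−k)` whose constant term is divisible by `p` (a slope
bound, `PadicCoeffBound`), and for `o ≥ 3` by Frobenius `F ≡ s^p − s (mod p)`.  With Theorem A (`v(c_{o,q}) ≥ o+1+E_x`,
`E_x ≥ −4` under `H(5)`) resp. Theorem A′ every class piece of `𝒦⁽⁴⁾_p` is divisible by `p`.  Valuation bookkeeping;
nothing about irrationality.
-/

noncomputable section

open Finset

namespace Summit.KontsevichZagierPeriods.Zeta5Search.ClusterValuation

open Summit.KontsevichZagierPeriods.Zeta5Search.WedgeDictionary (coeffU pfData dOf)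
open Summit.KontsevichZagierPeriods.Zeta5Search.CasoratianValuation (InPolytope)
open Summit.KontsevichZagierPeriods.Zeta5Search.BigPrime (momentVanishing_holds momentIntegral_holds)
open Summit.KontsevichZagierPeriods.Zeta5Search.PadicSeries

/-! ### The residue split for `U` -/

/-- `g⁽⁴⁾_o(k) = [(t+k)^o] (t^p − t)^4 = [(t+k)^o](t^{4p} − 4t^{3p+1} + 6t^{2p+2} − 4t^{p+3} + t^4)`. -/
def taylorT4 (p o : ℕ) (k : ℤ) : ℤ :=
  ((4 * p).choose o : ℤ) * (-k) ^ (4 * p - o) - 4 * ((3 * p + 1).choose o : ℤ) * (-k) ^ (3 * p + 1 - o)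
    + 6 * ((2 * p + 2).choose o : ℤ) * (-k) ^ (2 * p + 2 - o) - 4 * ((p + 3).choose o : ℤ) * (-k) ^ (p + 3 - o)
    + ((4 : ℕ).choose o : ℤ) * (-k) ^ (4 - o)

/-- `Ω⁽⁴⁾_p(b) := Σ_{o,q} c_{o,q} g⁽⁴⁾_o(q+1)`. -/
def omegaResU (b : ℕ → ℤ) (p : ℕ) : ℚ :=
  ∑ o ∈ range 6, ∑ q ∈ range ((b 0).toNat + 1), pfData b o q * (taylorT4 p o ((q : ℤ) + 1) : ℚ)

/-- `𝒦⁽⁴⁾_p(b) := Σ_{o,q} c_{o,q} (g⁽⁴⁾_o(q+1) − [o = 4])`. -/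
def kResU (b : ℕ → ℤ) (p : ℕ) : ℚ :=
  ∑ o ∈ range 6, ∑ q ∈ range ((b 0).toNat + 1),
    pfData b o q * ((taylorT4 p o ((q : ℤ) + 1) : ℚ) - if o = 4 then 1 else 0)

/-- **`U = Ω⁽⁴⁾_p − 𝒦⁽⁴⁾_p`** (definitional algebra). -/
theorem coeffU_eq_omegaResU_sub_kResU (b : ℕ → ℤ) (p : ℕ) : coeffU b = omegaResU b p - kResU b p := by
  simp only [coeffU, omegaResU, kResU, ← Finset.sum_sub_distrib, mul_sub, sub_sub_cancel, mul_ite, mul_one, mul_zero]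
  rw [Finset.sum_comm]
  refine Finset.sum_congr rfl fun q _ => ?_
  rw [Finset.sum_ite_eq' (range 6) 4 (fun o => pfData b o q)]
  simp

/-- **`Ω⁽⁴⁾_p = μ_{4p+1} − 4μ_{3p+2} + 6μ_{2p+3} − 4μ_{p+4} + μ_5`**. -/
theorem omegaResU_eq_moments (b : ℕ → ℤ) (p : ℕ) :
    omegaResU b p = momentAt b (4 * p + 1) - 4 * momentAt b (3 * p + 2) + 6 * momentAt b (2 * p + 3)
      - 4 * momentAt b (p + 4) + momentAt b 5 := by
  simp only [omegaResU, momentAt, taylorT4, Finset.mul_sum, ← Finset.sum_sub_distrib, ← Finset.sum_add_distrib]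
  refine Finset.sum_congr rfl fun o _ => Finset.sum_congr rfl fun q _ => ?_
  have h1 : 4 * p + 1 - 1 = 4 * p := by omega
  have h2 : 3 * p + 2 - 1 = 3 * p + 1 := by omega
  have h3 : 2 * p + 3 - 1 = 2 * p + 2 := by omega
  have h4 : p + 4 - 1 = p + 3 := by omega
  rw [h1, h2, h3, h4]
  push_cast
  ring

/-! ### The weights `g⁽⁴⁾_o(k) − [o=4]` -/

section Weights

open Polynomial

/-- `F_k(X) = (X − k)^p − (X − k)` over a ring. -/
def frobDiff (R : Type*) [CommRing R] (p : ℕ) (k : ℤ) : R[X] :=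
  (X + C ((-k : ℤ) : R)) ^ p - (X + C ((-k : ℤ) : R))

/-- `g⁽⁴⁾_o(k)` is the `o`-th coefficient of `F_k^4` over `ℤ`. -/
theorem taylorT4_eq_coeff (p o : ℕ) (k : ℤ) : taylorT4 p o k = (frobDiff ℤ p k ^ 4).coeff o := by
  have hexp : frobDiff ℤ p k ^ 4 = (X + C (-k)) ^ (4 * p) - C 4 * (X + C (-k)) ^ (3 * p + 1)
      + C 6 * (X + C (-k)) ^ (2 * p + 2) - C 4 * (X + C (-k)) ^ (p + 3) + (X + C (-k)) ^ 4 := by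
    have e1 : (X + C (-k) : ℤ[X]) ^ (4 * p) = ((X + C (-k)) ^ p) ^ 4 := by
      rw [show 4 * p = p * 4 by ring, pow_mul]
    have e2 : (X + C (-k) : ℤ[X]) ^ (3 * p + 1) = ((X + C (-k)) ^ p) ^ 3 * (X + C (-k)) := by
      rw [pow_succ, show 3 * p = p * 3 by ring, pow_mul]
    have e3 : (X + C (-k) : ℤ[X]) ^ (2 * p + 2) = ((X + C (-k)) ^ p) ^ 2 * (X + C (-k)) ^ 2 := by
      rw [pow_add, show 2 * p = p * 2 by ring, pow_mul]
    have e4 : (X + C (-k) : ℤ[X]) ^ (p + 3) = (X + C (-k)) ^ p * (X + C (-k)) ^ 3 := by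
      rw [pow_add]
    rw [e1, e2, e3, e4, show (C 4 : ℤ[X]) = 4 from map_ofNat C 4, show (C 6 : ℤ[X]) = 6 from map_ofNat C 6,
      frobDiff]
    simp only [Int.cast_id]
    ring
  rw [hexp, coeff_add, coeff_sub, coeff_add, coeff_sub, coeff_C_mul, coeff_C_mul, coeff_C_mul, coeff_X_add_C_pow,
    coeff_X_add_C_pow, coeff_X_add_C_pow, coeff_X_add_C_pow, coeff_X_add_C_pow, taylorT4]
  ring

/-- In characteristic `p`: `F_k^4 = (X^p − X)^4`. -/
theorem frobDiff_zmod (p : ℕ) [hp : Fact p.Prime] (k : ℤ) : frobDiff (ZMod p) p k = X ^ p - X := by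
  rw [frobDiff, add_pow_char, ← C_pow, ZMod.pow_card]
  ring

/-- **`p ∣ g⁽⁴⁾_o(k) − [o = 4]`** for `o ≤ 5` and a prime `p ≥ 5`. -/
theorem taylorT4_sub_dvd {p : ℕ} (hp : p.Prime) (h5 : 5 ≤ p) {o : ℕ} (ho : o < 6) (k : ℤ) :
    (p : ℤ) ∣ taylorT4 p o k - (if o = 4 then 1 else 0) := by
  haveI := Fact.mk hp
  have hc : ((taylorT4 p o k : ℤ) : ZMod p) = ((frobDiff ℤ p k ^ 4).map (Int.castRingHom (ZMod p))).coeff o := by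
    rw [Polynomial.coeff_map, ← taylorT4_eq_coeff, eq_intCast]
  have hmap : (frobDiff ℤ p k ^ 4).map (Int.castRingHom (ZMod p)) = frobDiff (ZMod p) p k ^ 4 := by
    rw [Polynomial.map_pow, frobDiff, frobDiff]
    simp only [Polynomial.map_sub, Polynomial.map_pow, Polynomial.map_add, Polynomial.map_C, Polynomial.map_X,
      Int.coe_castRingHom, Int.cast_id]
  have hsq : ((X : (ZMod p)[X]) ^ p - X) ^ 4 =
      X ^ (4 * p) - C 4 * X ^ (3 * p + 1) + C 6 * X ^ (2 * p + 2) - C 4 * X ^ (p + 3) + X ^ 4 := by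
    rw [show (C 4 : (ZMod p)[X]) = 4 from map_ofNat C 4, show (C 6 : (ZMod p)[X]) = 6 from map_ofNat C 6]; ring
  rw [← ZMod.intCast_zmod_eq_zero_iff_dvd, Int.cast_sub, hc, hmap, frobDiff_zmod, hsq,
    coeff_add, coeff_sub, coeff_add, coeff_sub, coeff_C_mul, coeff_C_mul, coeff_C_mul, coeff_X_pow, coeff_X_pow,
    coeff_X_pow, coeff_X_pow, coeff_X_pow, if_neg (by omega), if_neg (by omega), if_neg (by omega), if_neg (by omega)]
  split_ifs <;> simp

end Weights

variable {p : ℕ} [hp : Fact p.Prime]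

/-- `‖g⁽⁴⁾_o(k) − [o=4]‖_p ≤ p^{−1}` (`o ≤ 5`, `p ≥ 5`). -/
theorem padicNorm_taylorT4_sub_le (h5 : 5 ≤ p) {o : ℕ} (ho : o < 6) (k : ℤ) :
    padicNorm p ((taylorT4 p o k : ℚ) - if o = 4 then 1 else 0) ≤ (p : ℚ) ^ (-(1 : ℤ)) := by
  have h := taylorT4_sub_dvd hp.out h5 ho k
  have hcast : ((taylorT4 p o k : ℚ) - if o = 4 then 1 else 0) =
      (((taylorT4 p o k - (if o = 4 then 1 else 0) : ℤ)) : ℚ) := by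
    push_cast; split_ifs <;> simp
  rw [hcast]
  have := padicNorm.dvd_iff_norm_le.1 (show ((p ^ 1 : ℕ) : ℤ) ∣ taylorT4 p o k - (if o = 4 then 1 else 0) by simpa using h)
  simpa using this

/-- The slope bound of `F_k` over `ℚ`: `‖[X^j] F_k‖_p ≤ p^{j−1}` (the constant term `(−k)^p + k` is divisible by `p`). -/
theorem frobDiff_coeffBound (k : ℤ) : CoeffBound p 1 1 ((frobDiff ℚ p k : Polynomial ℚ) : PowerSeries ℚ) := by
  have hp1 := hp.out.one_lt
  intro j
  rw [Polynomial.coeff_coe]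
  have hint : (frobDiff ℚ p k).coeff j = (((frobDiff ℤ p k).coeff j : ℤ) : ℚ) := by
    have : frobDiff ℚ p k = (frobDiff ℤ p k).map (Int.castRingHom ℚ) := by
      rw [frobDiff, frobDiff]
      simp only [Polynomial.map_sub, Polynomial.map_pow, Polynomial.map_add, Polynomial.map_C, Polynomial.map_X,
        Int.coe_castRingHom, Int.cast_id]
    rw [this, Polynomial.coeff_map, eq_intCast]
  rw [hint]
  rcases Nat.eq_zero_or_pos j with rfl | hj
  · -- the constant term `(−k)^p − (−k)` is divisible by `p`
    have h0 : (frobDiff ℤ p k).coeff 0 = (-k) ^ p - (-k) := by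
      rw [frobDiff, Int.cast_id, Polynomial.coeff_sub, Polynomial.coeff_X_add_C_pow, Polynomial.coeff_add,
        Polynomial.coeff_X_zero, Polynomial.coeff_C_zero]
      simp
    have hdvd : (p : ℤ) ∣ (frobDiff ℤ p k).coeff 0 := by
      rw [h0, ← ZMod.intCast_zmod_eq_zero_iff_dvd]
      push_cast
      rw [ZMod.pow_card, sub_self]
    have := padicNorm.dvd_iff_norm_le.1 (show ((p ^ 1 : ℕ) : ℤ) ∣ (frobDiff ℤ p k).coeff 0 by simpa using hdvd)
    simpa using this
  · exact (padicNorm.of_int _).trans (one_le_zpow₀ one_le_p (by omega))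

/-- `‖g⁽⁴⁾_o(k)‖_p ≤ p^{−(4−o)}` (useful for `o ≤ 3`). -/
theorem padicNorm_taylorT4_le (k : ℤ) (o : ℕ) :
    padicNorm p ((taylorT4 p o k : ℚ)) ≤ (p : ℚ) ^ (-(4 - o : ℤ)) := by
  have h := (frobDiff_coeffBound (p := p) k).pow 4 o
  rw [← Polynomial.coe_pow, Polynomial.coeff_coe] at h
  have hcast : (taylorT4 p o k : ℚ) = ((frobDiff ℚ p k) ^ 4).coeff o := by
    have : (frobDiff ℚ p k) ^ 4 = ((frobDiff ℤ p k) ^ 4).map (Int.castRingHom ℚ) := by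
      rw [Polynomial.map_pow, frobDiff, frobDiff]
      simp only [Polynomial.map_sub, Polynomial.map_pow, Polynomial.map_add, Polynomial.map_C, Polynomial.map_X,
        Int.coe_castRingHom, Int.cast_id]
    rw [this, Polynomial.coeff_map, eq_intCast, taylorT4_eq_coeff]
  rw [hcast]
  refine h.trans (le_of_eq ?_)
  congr 1; push_cast; ring

/-- Combined weight bound: `‖g⁽⁴⁾_o(k) − [o=4]‖_p ≤ p^{−max(4−o, 1)}`, stated with the exponent `4 − min o 3`. -/
theorem padicNorm_weightU_le (h5 : 5 ≤ p) {o : ℕ} (ho : o < 6) (k : ℤ) :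
    padicNorm p ((taylorT4 p o k : ℚ) - if o = 4 then 1 else 0) ≤ (p : ℚ) ^ (-(4 - (min o 3 : ℕ) : ℤ)) := by
  rcases le_or_gt o 3 with h3 | h3
  · rw [if_neg (by omega), sub_zero, min_eq_left h3]
    exact padicNorm_taylorT4_le k o
  · rw [min_eq_right h3.le]
    simpa using padicNorm_taylorT4_sub_le (p := p) h5 ho k

/-! ### The class pieces of `𝒦⁽⁴⁾_p` under `H(5)` -/

/-- Class piece of `𝒦⁽⁴⁾_p`. -/
def classKU (b : ℕ → ℤ) (p x : ℕ) : ℚ :=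
  ∑ q ∈ classSet b p x, ∑ o ∈ range 6,
    pfData b o q * ((taylorT4 p o ((q : ℤ) + 1) : ℚ) - if o = 4 then 1 else 0)

omit hp in
/-- `𝒦⁽⁴⁾_p = Σ_x 𝒦⁽⁴⁾_x`. -/
theorem kResU_eq_sum_classKU (b : ℕ → ℤ) (hp0 : 0 < p) : kResU b p = ∑ x ∈ range p, classKU b p x := by
  unfold classKU
  rw [sum_classSet_eq b hp0, kResU, Finset.sum_comm]

/-- Under `H(5)`, every class piece of `𝒦⁽⁴⁾_p` is divisible by `p`. -/
theorem padicNorm_classKU_le (b : ℕ → ℤ) (hb : InPolytope b) (hp5 : 5 ≤ p) (hwin : (b 0 + 2 : ℤ) < (p : ℤ) ^ 2)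
    (hgood : GoodClasses b p 5) {x : ℕ} (hx : x < p) : padicNorm p (classKU b p x) ≤ (p : ℚ) ^ (-(1 : ℤ)) := by
  unfold classKU
  refine padicNorm.sum_le' (fun q hq => padicNorm.sum_le' (fun o ho => ?_) (zpow_p_nonneg _)) (zpow_p_nonneg _)
  have ho' := mem_range.1 ho
  have hqn : q ≤ (b 0).toNat := ((mem_classSet_iff b x q).1 hq).1
  rw [padicNorm.mul]
  by_cases h0 : pfData b o q = 0
  · rw [h0, padicNorm.zero, zero_mul]; exact zpow_p_nonneg _
  have hw := padicNorm_weightU_le (p := p) hp5 ho' ((q : ℤ) + 1)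
  rcases Nat.lt_trichotomy (classPoleCount b p x) 1 with hc | hc | hc
  · -- no pole: impossible, all `c_{o,q}` vanish
    exfalso
    exact h0 (pfData_eq_zero_of_netExp_nonneg b hb hqn (netExp_nonneg_of_noPole b (by omega) hq) ho')
  · -- single pole: `c_{o,q}` is `p`-integral
    have hcq : classPoleCount b p q = 1 := by
      unfold classPoleCount; rw [classSet_eq_of_mem hq]; exact hc
    have hv := isolatedPoleIntegral_holds b p q o hb hp.out (by omega) hwin hqn ho' h0 hcq
    have hcn : padicNorm p (pfData b o q) ≤ 1 := by
      rw [padicNorm.eq_zpow_of_nonzero h0]; exact zpow_le_one_of_nonpos₀ one_le_p (by linarith)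
    calc padicNorm p (pfData b o q) * _ ≤ 1 * (p : ℚ) ^ (-(4 - (min o 3 : ℕ) : ℤ)) :=
          mul_le_mul hcn hw (padicNorm.nonneg _) zero_le_one
      _ ≤ (p : ℚ) ^ (-(1 : ℤ)) := by
          rw [one_mul]; refine zpow_le_zpow_right₀ one_le_p ?_
          have : (min o 3 : ℕ) ≤ 3 := min_le_right _ _
          omega
  · -- multipole: Theorem A and `E_x ≥ −4`
    have hE : (-4 : ℤ) ≤ classExp b p x := by
      have := hgood x hx (by omega); push_cast at this; linarith
    have hA := clusterBound_holds b p q o hb hp.out (by omega) hwin hqn ho' h0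
    rw [classExp_eq_of_mem hq] at hA
    have hcn : padicNorm p (pfData b o q) ≤ (p : ℚ) ^ (-((o : ℤ) + 1 + classExp b p x)) := by
      rw [padicNorm.eq_zpow_of_nonzero h0]; exact zpow_le_zpow_right₀ one_le_p (by linarith)
    calc padicNorm p (pfData b o q) * _
        ≤ (p : ℚ) ^ (-((o : ℤ) + 1 + classExp b p x)) * (p : ℚ) ^ (-(4 - (min o 3 : ℕ) : ℤ)) :=
          mul_le_mul hcn hw (padicNorm.nonneg _) (zpow_p_nonneg _)
      _ ≤ (p : ℚ) ^ (-(1 : ℤ)) := by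
          rw [← zpow_add₀ (Nat.cast_ne_zero.2 hp.out.ne_zero)]
          refine zpow_le_zpow_right₀ one_le_p ?_
          have h1 : ((min o 3 : ℕ) : ℤ) ≤ o := by exact_mod_cast min_le_left _ _
          have h2 : ((min o 3 : ℕ) : ℤ) ≤ 3 := by exact_mod_cast min_le_right _ _
          omega

/-- Under `H(5)`: `‖𝒦⁽⁴⁾_p(b)‖_p ≤ p^{−1}`. -/
theorem padicNorm_kResU_le (b : ℕ → ℤ) (hb : InPolytope b) (hp5 : 5 ≤ p) (hwin : (b 0 + 2 : ℤ) < (p : ℤ) ^ 2)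
    (hgood : GoodClasses b p 5) : padicNorm p (kResU b p) ≤ (p : ℚ) ^ (-(1 : ℤ)) := by
  rw [kResU_eq_sum_classKU b hp.out.pos]
  exact padicNorm.sum_le' (fun x hx => padicNorm_classKU_le b hb hp5 hwin hgood (mem_range.1 hx)) (zpow_p_nonneg _)

/-- `‖Ω⁽⁴⁾_p(b)‖_p ≤ 1`. -/
theorem padicNorm_omegaResU_le_one (b : ℕ → ℤ) (hb : InPolytope b) (hp3 : 3 ≤ p) :
    padicNorm p (omegaResU b p) ≤ 1 := by
  have hμ : ∀ N, padicNorm p (momentAt b N) ≤ 1 := fun N => by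
    have h1 := padicNorm_le_of_val (p := p) (x := momentAt b N) (m := 0)
      (fun h => momentIntegral_holds b N p hb hp.out hp3 h)
    simpa using h1
  have hc : ∀ (c : ℕ) (N : ℕ), padicNorm p ((c : ℚ) * momentAt b N) ≤ 1 := fun c N => by
    rw [padicNorm.mul]
    calc padicNorm p (c : ℚ) * padicNorm p (momentAt b N) ≤ 1 * 1 :=
          mul_le_mul (padicNorm.of_nat _) (hμ N) (padicNorm.nonneg _) zero_le_one
      _ = 1 := one_mul 1
  rw [omegaResU_eq_moments]
  have h4 := hc 4 (3 * p + 2)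
  have h6 := hc 6 (2 * p + 3)
  have h4' := hc 4 (p + 4)
  push_cast at h4 h6 h4'
  refine (padicNorm.nonarchimedean (p := p)).trans (max_le ?_ (hμ 5))
  refine (padicNorm.sub (p := p)).trans (max_le ?_ h4')
  refine (padicNorm.nonarchimedean (p := p)).trans (max_le ?_ h6)
  exact (padicNorm.sub (p := p)).trans (max_le (hμ _) h4)

/-- `Ω⁽⁴⁾_p(b) = 0` when `4p ≤ 2d(b)+3`. -/
theorem omegaResU_eq_zero (b : ℕ → ℤ) (hb : InPolytope b) (hpd : 4 * (p : ℤ) ≤ 2 * dOf b + 3) :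
    omegaResU b p = 0 := by
  have h2 := hp.out.two_le
  rw [omegaResU_eq_moments, momentVanishing_holds b (4 * p + 1) hb (by omega) (by push_cast; omega),
    momentVanishing_holds b (3 * p + 2) hb (by omega) (by push_cast; omega),
    momentVanishing_holds b (2 * p + 3) hb (by omega) (by push_cast; omega),
    momentVanishing_holds b (p + 4) hb (by omega) (by push_cast; omega),
    momentVanishing_holds b 5 hb (by omega) (by push_cast; omega)]
  ring

/-- **THEOREM C for `U` is a theorem**: under `H(5)`, `U(b)` is `p`-integral and `p ∣ U(b)` for `4p ≤ 2d(b)+3`. -/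
theorem wrappedDivisibilityU_holds : WrappedDivisibilityU := by
  intro b p hb hprime hp5 hwin hgood hU
  haveI : Fact p.Prime := ⟨hprime⟩
  have hK := padicNorm_kResU_le b hb hp5 hwin hgood
  apply val_ge_of_padicNorm_le hU
  rw [coeffU_eq_omegaResU_sub_kResU b p]
  split_ifs with hpd
  · rw [omegaResU_eq_zero b hb hpd, zero_sub, padicNorm.neg]
    exact hK
  · refine (padicNorm.sub (p := p)).trans (max_le ?_ (hK.trans (zpow_le_zpow_right₀ one_le_p (by norm_num))))
    simpa using padicNorm_omegaResU_le_one b hb (by omega)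

end Summit.KontsevichZagierPeriods.Zeta5Search.ClusterValuation

end
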